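import Mathlib
import Literature.NumberTheory.Transcendental.KZCalculus
import Literature.NumberTheory.Transcendental.KZLogCalculusProofs
import Summits.KontsevichZagierPeriods.KontsevichZagierPeriods.Theorems.TorsionLogsNeronTorsionSectorStubHaarReps
import Summits.KontsevichZagierPeriods.KontsevichZagierPeriods.Theorems.TorsionLogsNeronTorsionSectorStubCellStepInst
import Summits.KontsevichZagierPeriods.KontsevichZagierPeriods.Theorems.TorsionLogsNeronTorsionSectorStubLowerRegular
import Summits.KontsevichZagierPeriods.KontsevichZagierPeriods.Theorems.TorsionLogsNeronTorsionSectorStubRIReduction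
import Summits.KontsevichZagierPeriods.KontsevichZagierPeriods.Theorems.TorsionLogsNeronTorsionSectorAssemblyRows
import Summits.KontsevichZagierPeriods.KontsevichZagierPeriods.Theorems.TorsionLogsNeronTorsionSectorAssemblyDecomp
import Summits.KontsevichZagierPeriods.KontsevichZagierPeriods.Theorems.TorsionLogsNeronTorsionSectorAssemblyObjects
import Summits.KontsevichZagierPeriods.KontsevichZagierPeriods.Theorems.TorsionLogsNeronTorsionSectorAssemblyColumns
import Literature.NumberTheory.Transcendental.EllIterRepShuffle
import HarnessLib

/-!
# Crux `TorsionLogs.NeronTorsionSector` (stmt-KontsevichZagierPeriods-14500) — assembly, the decomposition slice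

Helper for the lead's stub `stub_assembly` (line `registered`): the two second-kind plane representations of the
crux against the interface reps: Step 0 turns `[rI]` into a log carrier minus `ℍ(T)` (`stub_rIReduction`), `ℍ(T)`
decomposes along the grid into the half-cells `t_j` and `(j − aa)` copies of the column-1 cells `c_j`
(`asmDecomp_triangle`, column shifts `asmCol_shift`), and `[rP] = 2ℍ(□)` decomposes into `2m` copies of
`Σ_j c_j` (`asmDecomp_box`). [cite: KontsevichZagier2001, §1.2 rule (1)]
-/

noncomputable section

open Set MeasureTheory Filter Topology
open Literature.NumberTheory.Transcendental Literature.NumberTheory.Transcendental.KZ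
open Literature.ModelTheory.ExponentialFields
open Summit.KontsevichZagierPeriods.HyperbolicBloch.OffTetraSectorKernel (isSemialgebraic_logIvl exists_logRep)

-- `Summit.KontsevichZagierPeriods.KontsevichZagierPeriods.…` is the tree's mandated layout (single-conjunct summit).
set_option linter.dupNamespace false

namespace Summit.KontsevichZagierPeriods.KontsevichZagierPeriods.Cruxes.NeronTorsionSector.Translation

/-- Double counting of the cells above the diagonal:
`Σ_{aa ≤ i < m} Σ_{i < j < m} g j = Σ_{aa ≤ j < m} (j − aa)•g j`. [folklore] -/
theorem asmS3_double_count {A : Type*} [AddCommGroup A] (g : ℕ → A) (aa : ℕ) :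
    ∀ m, aa ≤ m → ∑ i ∈ Finset.Ico aa m, ∑ j ∈ Finset.Ioo i m, g j =
      ∑ j ∈ Finset.Ico aa m, ((j : ℤ) - (aa : ℤ)) • g j := by
  intro m hm
  induction m, hm using Nat.le_induction with
  | base => simp
  | succ k hk ih =>
    rw [Finset.sum_Ico_succ_top hk, Finset.sum_Ico_succ_top hk, ← Finset.Ico_add_one_left_eq_Ioo, Finset.Ico_self,
      Finset.sum_empty, add_zero]
    have h : ∀ i ∈ Finset.Ico aa k, ∑ j ∈ Finset.Ioo i (k + 1), g j = ∑ j ∈ Finset.Ioo i k, g j + g k := by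
      intro i hi
      rw [Finset.mem_Ico] at hi
      rw [← Finset.Ico_add_one_left_eq_Ioo, ← Finset.Ico_add_one_left_eq_Ioo,
        Finset.sum_Ico_succ_top (show i + 1 ≤ k from hi.2)]
    rw [Finset.sum_congr rfl h, Finset.sum_add_distrib, ih, Finset.sum_const, Nat.card_Ico,
      ← Nat.cast_smul_eq_nsmul ℤ (k - aa) (g k), Nat.cast_sub hk]

/-- The integrand of `rP` is twice the second-kind kernel. [folklore] -/
theorem asmS3_rP_identity (N z A B : ℝ) (hz : z ≠ 0) (hA : A ≠ 0) (hB : B ≠ 0) :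
    A⁻¹ * (N / (2 * z ^ 2 * B)) = N / (4 * z ^ 2) / (A * B) + N / (4 * z ^ 2) / (A * B) := by
  field_simp
  ring

/-- **The decomposition slice** (see the module docstring). [cite: KontsevichZagier2001, §1.2 rule (1)] -/
theorem asmS3_decomp :
    ∀ (g₂ g₃ e₁ L₁ : ℝ) (m : ℕ) (x y : ℕ → ℝ) (f yb sl τ Y3 Qf sl3 X33 Y33 Qf3 Pg G τ' : ℝ → ℝ),
    (∀ t, f t = 4 * t ^ 3 - g₂ * t - g₃) → f e₁ = 0 → 0 < e₁ → (∀ t, e₁ < t → 0 < f t) →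
    6 ≤ m → x m = e₁ →
    (∀ k, 1 ≤ k → k < m → e₁ < x k ∧ y k < 0) → (∀ k, 1 ≤ k → k < m → x (k + 1) < x k) →
    (∀ k, 1 ≤ k → k ≤ m → IsAlgebraic ℚ (x k)) →
    (∀ k, 1 ≤ k → k < m → IsAlgebraic ℚ (y k) ∧ y k ^ 2 = f (x k)) →
    IsAlgebraic ℚ g₂ → IsAlgebraic ℚ g₃ →
    L₁ = (12 * x 1 ^ 2 - g₂) / (2 * y 1) → x 2 = L₁ ^ 2 / 4 - 2 * x 1 → y 2 = -(y 1 + L₁ * (x 2 - x 1)) →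
    yb = (fun t => -Real.sqrt (f t)) →
    sl = (fun t => (4 * t ^ 2 + 4 * t * x 1 + 4 * x 1 ^ 2 - g₂) / (yb t + y 1)) →
    τ = (fun t => sl t ^ 2 / 4 - t - x 1) →
    Y3 = (fun t => -(yb t + sl t * (τ t - t))) →
    Qf = (fun t => sl t / 2 + Y3 t / (2 * τ t) - yb t / (2 * t)) →
    sl3 = (fun t => (4 * τ t ^ 2 + 4 * τ t * x 1 + 4 * x 1 ^ 2 - g₂) / (Y3 t + y 1)) →
    X33 = (fun t => sl3 t ^ 2 / 4 - τ t - x 1) →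
    Y33 = (fun t => -(Y3 t + sl3 t * (X33 t - τ t))) →
    Qf3 = (fun t => sl3 t / 2 + Y33 t / (2 * X33 t) - Y3 t / (2 * τ t)) →
    Pg = (fun t => 4 * (t + 2 * x 1) * y 1 - L₁ * (4 * t ^ 2 + 4 * t * x 1 + 4 * x 1 ^ 2 - g₂)
      + 4 * (t + 2 * x 1) * yb t) →
    G = (fun t => Pg t / (yb t + y 1) ^ 2 * Real.sqrt (t * X33 t) / τ t) →
    τ' = (fun t => Y3 t / yb t) →
    MeasureTheory.IntegrableOn (fun t => (Real.sqrt (f t))⁻¹) (Set.Ioi e₁) →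
    StrictMonoOn τ (Set.Ici (x 1)) → τ '' Set.Ioi (x 1) = Set.Ioo (x 2) (x 1) →
    (∀ k, 1 ≤ k → k + 2 ≤ m → StrictMonoOn τ (Set.Icc (x (k + 1)) (x k)) ∧
      τ '' Set.Ioo (x (k + 1)) (x k) = Set.Ioo (x (k + 2)) (x (k + 1)) ∧
      τ (x k) = x (k + 1) ∧ τ (x (k + 1)) = x (k + 2)) →
    StrictAntiOn τ (Set.Icc e₁ (x (m - 1))) → τ '' Set.Ioo e₁ (x (m - 1)) = Set.Ioo e₁ (x (m - 1)) →
    τ e₁ = x (m - 1) → τ (x (m - 1)) = e₁ →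
    ∀ (aa : ℕ) (xP : ℝ) (rI rP : IntegralRep 2) (Tx C1 : ℕ → IntegralRep 2) (C10 : IntegralRep 2),
    1 ≤ aa → aa < m → x aa = xP → IsAlgebraic ℚ xP →
    rI.domain = {z | e₁ < z 1 ∧ z 1 < z 0 ∧ z 0 < xP} →
    Set.EqOn rI.integrand (fun z => z 1 / (Real.sqrt (f (z 1)) * Real.sqrt (f (z 0)))) rI.domain →
    rP.domain = {z | e₁ < z 0 ∧ e₁ < z 1} →
    Set.EqOn rP.integrand
      (fun z => (Real.sqrt (f (z 0)))⁻¹ * ((g₂ * z 1 + 2 * g₃) / (2 * (z 1) ^ 2 * Real.sqrt (f (z 1))))) rP.domain →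
    (∀ j, 1 ≤ j → j < m → (Tx j).domain = {z | x (j + 1) < z 1 ∧ z 1 < z 0 ∧ z 0 < x j} ∧
      Set.EqOn (Tx j).integrand (fun z => (g₂ * z 1 + 2 * g₃) / (4 * (z 1) ^ 2) / (Real.sqrt (f (z 0)) * Real.sqrt (f (z 1)))) (Tx j).domain) →
    (∀ j, 1 ≤ j → j < m → (C1 j).domain = {z | (x 2 < z 0 ∧ z 0 < x 1) ∧ x (j + 1) < z 1 ∧ z 1 < x j} ∧
      Set.EqOn (C1 j).integrand (fun z => (g₂ * z 1 + 2 * g₃) / (4 * (z 1) ^ 2) / (Real.sqrt (f (z 0)) * Real.sqrt (f (z 1)))) (C1 j).domain) →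
    C10.domain = {z | (x 2 < z 0 ∧ z 0 < x 1) ∧ x 1 < z 1} →
    Set.EqOn C10.integrand (fun z => (g₂ * z 1 + 2 * g₃) / (4 * (z 1) ^ 2) / (Real.sqrt (f (z 0)) * Real.sqrt (f (z 1)))) C10.domain →
    ∃ rB₀ : IntegralRep 1,
      rB₀.domain = {t | 1 < t 0 ∧ t 0 < Real.sqrt (xP / e₁)} ∧ Set.EqOn rB₀.integrand (fun t => 1 / t 0) rB₀.domain ∧
      of rI - of rB₀ + (∑ j ∈ Finset.Ico aa m, of (Tx j) + ∑ j ∈ Finset.Ico aa m, ((j : ℤ) - (aa : ℤ)) • of (C1 j)) ∈ relations ∧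
      of rP - (2 * (m : ℤ)) • ∑ j ∈ Finset.range m, (if j = 0 then of C10 else of (C1 j)) ∈ relations := by
  intro g₂ g₃ e₁ L₁ m x y f yb sl τ Y3 Qf sl3 X33 Y33 Qf3 Pg G τ' hf he₁ he₁pos hfpos hm6 hxm hgLow hgDec hgAlg'
    hgAlgy ag₂ ag₃ hL₁ hx2 hy2 hyb hsl hτ hY3 hQf hsl3 hX33 hY33 hQf3 hPg hG hτ' hInt hτmono0 hτimg0 hτcell hτfanti hτfimg
    hτe₁ hτm1 aa xP rI rP Tx C1 C10 haa1 haam hxaa hxPa hrId hrIi hrPd hrPi hTx hC1 hC10d hC10i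
  have hx1 : e₁ < x 1 ∧ y 1 < 0 := hgLow 1 le_rfl (lt_of_lt_of_le (by norm_num) hm6)
  have h1m : 1 < m := lt_of_lt_of_le (by norm_num) hm6
  have h2m : 2 < m := lt_of_lt_of_le (by norm_num) hm6
  have h3m : 3 < m := lt_of_lt_of_le (by norm_num) hm6
  have hmm : m ≤ m := le_rfl
  have hm1 : m - 1 + 1 = m := Nat.sub_add_cancel h1m.le
  have hm1lt : m - 1 < m := Nat.sub_lt (Nat.zero_lt_of_lt h1m) Nat.one_pos
  have h1m1 : 1 ≤ m - 1 := Nat.le_sub_one_of_lt h1m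
  have hx1pos : 0 < x 1 := he₁pos.trans hx1.1
  have hx1alg : IsAlgebraic ℚ (x 1) := hgAlg' 1 le_rfl h1m.le
  have hy1 : IsAlgebraic ℚ (y 1) ∧ y 1 ^ 2 = f (x 1) := hgAlgy 1 le_rfl h1m
  have hx2low : e₁ < x 2 ∧ y 2 < 0 := hgLow 2 (by norm_num) h2m
  have hx2pos : 0 < x 2 := he₁pos.trans hx2low.1
  have hx2alg : IsAlgebraic ℚ (x 2) := hgAlg' 2 (by norm_num) h2m.le
  have hx21 : x 2 < x 1 := hgDec 1 le_rfl h1m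
  have he₁a : IsAlgebraic ℚ e₁ := by rw [← hxm]; exact hgAlg' m h1m.le hmm
  have hanti := asmDecomp_anti x m hgDec
  have hsanti := asmDecomp_strictAnti x m hgDec
  classical
  have hm0 : 0 < m := Nat.zero_lt_of_lt h1m
  obtain ⟨-, -, -, -, hsemi, hrows, -⟩ := asmRows_package g₂ g₃ e₁ L₁ m x y f yb sl τ Y3 Qf sl3 X33 Y33 Qf3 Pg G
    τ' hf he₁ he₁pos hfpos hm6 hxm hgLow hgDec hgAlg' hy1.2 hy1.1 ag₂ ag₃ hL₁ hx2 hy2 hyb hsl hτ hY3 hQf hsl3 hX33 hY33 hQf3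
    hPg hG hτ' hτmono0 hτimg0 hτcell hτfanti hτfimg hτe₁ hτm1
  obtain ⟨-, L2, -, -, -, -, -⟩ := stub_lowerRegular g₂ g₃ e₁ (x 1) (y 1) (x 2) (y 2) L₁ (x (m - 1)) f yb sl τ Y3 Qf sl3 X33 Y33
    Qf3 Pg G τ' hf he₁ he₁pos hfpos hx1.1 hy1.2 hx1.2 hL₁ hx2 hy2 hx2low.1 hx2low.2 ag₂ ag₃ hx1alg hy1.1 hyb hsl hτ hY3 hQf hsl3
    hX33 hY33 hQf3 hPg hG hτ'
  /- `ℍ(□)` and its cells -/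
  set Cb : ℝ := |g₂| / (4 * e₁) + |g₃| / (2 * e₁ ^ 2) with hCb
  have hCbd : ∀ t, e₁ < t → |(g₂ * t + 2 * g₃) / (4 * t ^ 2)| ≤ Cb := by
    intro t ht
    have ht0 : 0 < t := he₁pos.trans ht
    rw [abs_div, abs_of_pos (by positivity : (0:ℝ) < 4 * t ^ 2), hCb]
    calc |g₂ * t + 2 * g₃| / (4 * t ^ 2) ≤ (|g₂| * t + 2 * |g₃|) / (4 * t ^ 2) := by
            gcongr
            calc |g₂ * t + 2 * g₃| ≤ |g₂ * t| + |2 * g₃| := abs_add_le _ _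
              _ = |g₂| * t + 2 * |g₃| := by rw [abs_mul, abs_mul, abs_of_pos ht0, abs_two]
      _ = |g₂| / (4 * t) + |g₃| / (2 * t ^ 2) := by field_simp; ring
      _ ≤ |g₂| / (4 * e₁) + |g₃| / (2 * e₁ ^ 2) := by gcongr
  have hIoiσ : IsSemialgebraic ℚ {p : Fin 1 → ℝ | p 0 ∈ Set.Ioi e₁} := isSemialgebraic_setOf_const_lt_apply he₁a 0
  obtain ⟨Hbox, hHboxd, hHboxi⟩ := stub_haarReps.2 g₂ g₃ e₁ Cb f (fun t => (g₂ * t + 2 * g₃) / (4 * t ^ 2)) (Set.Ioi e₁)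
    {z | e₁ < z 0 ∧ e₁ < z 1} ag₂ ag₃ he₁a hf hfpos hInt subset_rfl hIoiσ
    (cellStep_isSemialgebraicFunOn_kernel hIoiσ ag₂ ag₃ fun p hp => (he₁pos.trans hp).ne')
    (ContinuousOn.div (by fun_prop) (by fun_prop) fun t ht => by have : 0 < t := he₁pos.trans ht; positivity)
    (fun t ht => hCbd t ht) (asmObj_isSemialgebraic_quadrant he₁a) (fun z hz => ⟨hz.1, hz.2⟩)
  let row : ℕ → Set ℝ := fun j => if j = 0 then Set.Ioi (x 1) else Set.Ioo (x (j + 1)) (x j)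
  have hrow0 : row 0 = Set.Ioi (x 1) := by simp [row]
  have hrow : ∀ j, 1 ≤ j → row j = Set.Ioo (x (j + 1)) (x j) := fun j hj => by
    simp [row, Nat.one_le_iff_ne_zero.mp hj]
  have hHboxd' : Hbox.domain = {z | x m < z 0 ∧ x m < z 1} := by rw [hHboxd, hxm]
  obtain ⟨cell, hcell, hboxrel⟩ := asmDecomp_box x m row Hbox h1m.le hgDec hgAlg' hrow0 hrow hHboxd'
  have hcelld : ∀ i j, i < m → j < m → (cell (i, j)).domain = {z | z 0 ∈ row i ∧ z 1 ∈ row j} :=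
    fun i j hi hj => (hcell i j hi hj).1
  have hcelli' : ∀ i j, i < m → j < m → Set.EqOn (cell (i, j)).integrand (fun z => (g₂ * z 1 + 2 * g₃) / (4 * (z 1) ^ 2) / (Real.sqrt (f (z 0)) * Real.sqrt (f (z 1)))) (cell (i, j)).domain :=
    fun i j hi hj z _ => by rw [(hcell i j hi hj).2, hHboxi]
  /- column shifts -/
  have hrowσ : ∀ i, i < m → IsSemialgebraic ℚ {p : Fin 1 → ℝ | p 0 ∈ row i} := by
    intro i hi
    rcases Nat.eq_zero_or_pos i with rfl | hipos
    · rw [hrow0]; exact isSemialgebraic_setOf_const_lt_apply hx1alg 0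
    · rw [hrow i hipos]; exact isSemialgebraic_logIvl (hgAlg' (i + 1) (Nat.le_add_left 1 i) hi) (hgAlg' i hipos hi.le)
  have hxk_gt : ∀ k, 1 ≤ k → k ≤ m → ∀ t, x k < t → e₁ < t := fun k hk hkm t ht =>
    lt_of_le_of_lt (hxm.symm.le.trans (hanti k m hk hkm hmm)) ht
  have hrow_facts : ∀ i, i + 2 ≤ m → Set.InjOn τ (row i) ∧ τ '' row i = row (i + 1) ∧
      (∀ t ∈ row i, HasDerivAt τ (τ' t) t ∧ |τ' t| * Real.sqrt (f t) = Real.sqrt (f (τ t)) ∧ 0 < f t ∧ 0 < f (τ t)) := by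
    intro i him
    rcases Nat.eq_zero_or_pos i with rfl | hipos
    · rw [hrow0, hrow 1 le_rfl]
      refine ⟨hτmono0.injOn.mono Set.Ioi_subset_Ici_self, hτimg0, fun t ht => ?_⟩
      have hτt : τ t ∈ Set.Ioo (x 2) (x 1) := by rw [← hτimg0]; exact ⟨t, ht, rfl⟩
      have he : e₁ < t := hx1.1.trans ht
      obtain ⟨hd, -, hhaar, -⟩ := L2 t he (hx2low.1.trans hτt.1)
      exact ⟨hd, hhaar, hfpos t he, hfpos _ (hx2low.1.trans hτt.1)⟩
    · rw [hrow i hipos, hrow (i + 1) (Nat.le_add_left 1 i)]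
      obtain ⟨hmono, himg, -, -⟩ := hτcell i hipos him
      obtain ⟨hrange, hstep, -⟩ := hrows i hipos him
      refine ⟨hmono.injOn.mono Ioo_subset_Icc_self, himg, fun t ht => ⟨(hstep t ht).1, (hstep t ht).2,
        hfpos t (hrange t (Ioo_subset_Icc_self ht)).1, hfpos _ ?_⟩⟩
      have : τ t ∈ Set.Ioo (x (i + 2)) (x (i + 1)) := by rw [← himg]; exact ⟨t, ht, rfl⟩
      exact hxk_gt (i + 2) (Nat.le_add_left 1 (i + 1)) him _ this.1
  have hcol : ∀ i j, i + 2 ≤ m → j < m → of (cell (i, j)) - of (cell (i + 1, j)) ∈ relations := by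
    intro i j him hjm
    have hi1m : i + 1 < m := him
    obtain ⟨hinj, himg, hfacts⟩ := hrow_facts i him
    exact asmCol_shift g₂ g₃ f τ τ' (row i) (row (i + 1)) (row j) (cell (i, j)) (cell (i + 1, j))
      (hrowσ i (Nat.lt_of_succ_lt hi1m)) (hsemi _ (hrowσ i (Nat.lt_of_succ_lt hi1m))).1 hinj himg hfacts
      (hcelld i j (Nat.lt_of_succ_lt hi1m) hjm) (hcelld (i + 1) j hi1m hjm) (hcelli' i j (Nat.lt_of_succ_lt hi1m) hjm)
      (hcelli' (i + 1) j hi1m hjm)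
  have hcol_to1 : ∀ i j, 1 ≤ i → i < m → j < m → of (cell (i, j)) - of (cell (1, j)) ∈ relations := by
    intro i j hi him hjm
    induction i, hi using Nat.le_induction with
    | base => rw [sub_self]; exact relations.zero_mem
    | succ k hk ih =>
      rw [← sub_sub_sub_cancel_left (of (cell (1, j))) (of (cell (k + 1, j))) (of (cell (k, j)))]
      exact relations.sub_mem (ih (Nat.lt_of_succ_lt him)) (hcol k j him hjm)
  -- identification of the column-1 cells with the interface reps
  let Cf : ℕ → FormalRep := fun j => if j = 0 then of C10 else of (C1 j)
  have hC1_cell : ∀ j, j < m → of (cell (1, j)) - Cf j ∈ relations := by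
    intro j hjm
    rcases Nat.eq_zero_or_pos j with rfl | hjpos
    · simp only [Cf, if_true]
      have hdd : C10.domain = (cell (1, 0)).domain := by rw [hC10d, hcelld 1 0 h1m hm0, hrow 1 le_rfl, hrow0]; rfl
      exact KZ.of_sub_of_mem_relations_of_eqOn hdd fun z hz => by rw [hcelli' 1 0 h1m hm0 hz, hC10i (by rw [hdd]; exact hz)]
    · simp only [Cf, Nat.one_le_iff_ne_zero.mp hjpos, if_false]
      have hdd : (C1 j).domain = (cell (1, j)).domain := by
        rw [(hC1 j hjpos hjm).1, hcelld 1 j h1m hjm, hrow 1 le_rfl, hrow j hjpos]; rfl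
      exact KZ.of_sub_of_mem_relations_of_eqOn hdd fun z hz => by
        rw [hcelli' 1 j h1m hjm hz, (hC1 j hjpos hjm).2 (by rw [hdd]; exact hz)]
  /- `[rP] ≡ (2m) • Σ_j c_j` -/
  have hrP2 : of rP - 2 • of Hbox ∈ relations := by
    have h := KZ.integrandAddRel_subset_relations ⟨2, rP, Hbox, Hbox, by rw [hHboxd, hrPd], by rw [hHboxd, hrPd],
      fun z hz => ?_, rfl⟩
    · rw [two_nsmul, ← sub_sub]; exact h
    · rw [hrPd] at hz
      rw [Pi.add_apply, hrPi (by rw [hrPd]; exact hz), hHboxi]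
      exact asmS3_rP_identity _ _ _ _ (he₁pos.trans hz.2).ne' (Real.sqrt_pos.2 (hfpos _ hz.1)).ne'
        (Real.sqrt_pos.2 (hfpos _ hz.2)).ne'
  have hbox_cells : of Hbox - (m : ℤ) • ∑ j ∈ Finset.range m, Cf j ∈ relations := by
    have h1 : ∑ ij ∈ Finset.range m ×ˢ Finset.range m, of (cell ij) -
        ∑ i ∈ Finset.range m, ∑ j ∈ Finset.range m, Cf j ∈ relations := by
      rw [Finset.sum_product, ← Finset.sum_sub_distrib]
      refine sum_mem fun i hi => ?_
      rw [← Finset.sum_sub_distrib]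
      refine sum_mem fun j hj => ?_
      rw [Finset.mem_range] at hi hj
      rw [← sub_add_sub_cancel (of (cell (i, j))) (of (cell (1, j))) (Cf j)]
      refine relations.add_mem ?_ (hC1_cell j hj)
      rcases Nat.eq_zero_or_pos i with rfl | hipos
      · exact hcol 0 j h1m hj
      · exact hcol_to1 i j hipos hi hj
    have h2 : ∑ i ∈ Finset.range m, ∑ j ∈ Finset.range m, Cf j = (m : ℤ) • ∑ j ∈ Finset.range m, Cf j := by
      rw [Finset.sum_const, Finset.card_range, Nat.cast_smul_eq_nsmul]
    rw [← h2, ← sub_add_sub_cancel (of Hbox) (∑ ij ∈ Finset.range m ×ˢ Finset.range m, of (cell ij)) _]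
    exact relations.add_mem hboxrel h1
  /- `ℍ(T)` and its decomposition -/
  have hTsub : rI.domain ⊆ Hbox.domain := by
    rw [hrId, hHboxd]; intro z ⟨h1, h2, _⟩; exact ⟨h1.trans h2, h1⟩
  set HT : IntegralRep 2 := Hbox.restrict rI.domain rI.isSemialgebraic_domain hTsub with hHT
  have hHTd : HT.domain = {z | x m < z 1 ∧ z 1 < z 0 ∧ z 0 < x aa} := by
    simp only [hHT, IntegralRep.domain_restrict, hrId, hxm, hxaa]
  have hHTi : HT.integrand = Hbox.integrand := by simp only [hHT, IntegralRep.integrand_restrict]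
  obtain ⟨Th, Rt, hTh, hRt, hTrel⟩ := asmDecomp_triangle x m aa row HT haa1 haam hgDec hgAlg' hrow0 hrow hHTd
  have hHT' : of HT - (∑ j ∈ Finset.Ico aa m, of (Tx j) + ∑ j ∈ Finset.Ico aa m, ((j : ℤ) - (aa : ℤ)) • of (C1 j)) ∈ relations := by
    have hTh_Tx : ∀ i ∈ Finset.Ico aa m, of (Th i) - of (Tx i) ∈ relations := by
      intro i hi; rw [Finset.mem_Ico] at hi
      have hi1 : 1 ≤ i := haa1.trans hi.1
      refine KZ.of_sub_of_mem_relations_of_eqOn (by rw [(hTx i hi1 hi.2).1, (hTh i hi.1 hi.2).1]) fun z hz => ?_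
      rw [(hTh i hi.1 hi.2).2, hHTi, hHboxi, (hTx i hi1 hi.2).2 (by rw [(hTx i hi1 hi.2).1, ← (hTh i hi.1 hi.2).1]; exact hz)]
    have hRt_C : ∀ i ∈ Finset.Ico aa m, ∀ j ∈ Finset.Ioo i m, of (Rt (i, j)) - of (C1 j) ∈ relations := by
      intro i hi j hj; rw [Finset.mem_Ico] at hi; rw [Finset.mem_Ioo] at hj
      have hi1 : 1 ≤ i := haa1.trans hi.1
      have hj1 : 1 ≤ j := hi1.trans hj.1.le
      have h1 : of (Rt (i, j)) - of (cell (i, j)) ∈ relations :=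
        KZ.of_sub_of_mem_relations_of_eqOn (by rw [hcelld i j hi.2 hj.2, (hRt i j hi.1 hj.1 hj.2).1]) fun z hz => by
          rw [(hRt i j hi.1 hj.1 hj.2).2, hHTi, hHboxi, hcelli' i j hi.2 hj.2 (by rw [hcelld i j hi.2 hj.2, ← (hRt i j hi.1 hj.1 hj.2).1]; exact hz)]
      have h3 := hC1_cell j hj.2
      simp only [Cf, Nat.one_le_iff_ne_zero.mp hj1, if_false] at h3
      rw [← sub_add_sub_cancel (of (Rt (i, j))) (of (cell (i, j))) _, ← sub_add_sub_cancel (of (cell (i, j))) (of (cell (1, j))) _]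
      exact relations.add_mem h1 (relations.add_mem (hcol_to1 i j hi1 hi.2 hj.2) h3)
    have hsum1 : ∑ i ∈ Finset.Ico aa m, of (Th i) - ∑ j ∈ Finset.Ico aa m, of (Tx j) ∈ relations := by
      rw [← Finset.sum_sub_distrib]; exact sum_mem hTh_Tx
    have hsum2 : ∑ i ∈ Finset.Ico aa m, ∑ j ∈ Finset.Ioo i m, of (Rt (i, j)) -
        ∑ j ∈ Finset.Ico aa m, ((j : ℤ) - (aa : ℤ)) • of (C1 j) ∈ relations := by
      rw [← asmS3_double_count (fun j => of (C1 j)) aa m haam.le, ← Finset.sum_sub_distrib]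
      refine sum_mem fun i hi => ?_
      rw [← Finset.sum_sub_distrib]; exact sum_mem (hRt_C i hi)
    rw [show of HT - (∑ j ∈ Finset.Ico aa m, of (Tx j) + ∑ j ∈ Finset.Ico aa m, ((j : ℤ) - (aa : ℤ)) • of (C1 j)) =
        (of HT - (∑ i ∈ Finset.Ico aa m, of (Th i) + ∑ i ∈ Finset.Ico aa m, ∑ j ∈ Finset.Ioo i m, of (Rt (i, j))))
        + (∑ i ∈ Finset.Ico aa m, of (Th i) - ∑ j ∈ Finset.Ico aa m, of (Tx j))
        + (∑ i ∈ Finset.Ico aa m, ∑ j ∈ Finset.Ioo i m, of (Rt (i, j)) -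
            ∑ j ∈ Finset.Ico aa m, ((j : ℤ) - (aa : ℤ)) • of (C1 j)) by abel]
    exact relations.add_mem (relations.add_mem hTrel hsum1) hsum2
  /- Step 0 and the conclusion -/
  obtain ⟨rB₀, hrB₀d, hrB₀i, hrIrel⟩ := stub_rIReduction g₂ g₃ e₁ xP f rI HT hf he₁ he₁pos hfpos
    (by rw [← hxaa]; exact (hgLow aa haa1 haam).1) ag₂ ag₃ he₁a hxPa hInt hrId hrIi (by rw [hHTd, hxm, hxaa])
    (fun z _ => by rw [hHTi, hHboxi])
  refine ⟨rB₀, hrB₀d, hrB₀i, ?_, ?_⟩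
  · rw [show of rI - of rB₀ + (∑ j ∈ Finset.Ico aa m, of (Tx j) + ∑ j ∈ Finset.Ico aa m, ((j : ℤ) - (aa : ℤ)) • of (C1 j)) =
      (of rI + of HT - of rB₀) - (of HT - (∑ j ∈ Finset.Ico aa m, of (Tx j) +
        ∑ j ∈ Finset.Ico aa m, ((j : ℤ) - (aa : ℤ)) • of (C1 j))) by abel]
    exact relations.sub_mem hrIrel hHT'
  · rw [show of rP - (2 * (m : ℤ)) • ∑ j ∈ Finset.range m, Cf j =
      (of rP - 2 • of Hbox) + 2 • (of Hbox - (m : ℤ) • ∑ j ∈ Finset.range m, Cf j) by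
        rw [mul_zsmul, two_zsmul, two_nsmul, two_nsmul]; abel]
    exact relations.add_mem hrP2 (relations.nsmul_mem hbox_cells 2)

end Summit.KontsevichZagierPeriods.KontsevichZagierPeriods.Cruxes.NeronTorsionSector.Translation
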